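import Summits.ResolutionOfSingularities.ResolutionOfSingularities.Theorems.FrobeniusLadderFInjectiveMacaulayficationTauFloorOneCIChartIdent
import Summits.ResolutionOfSingularities.ResolutionOfSingularities.Theorems.FrobeniusLadderFInjectiveMacaulayficationTauFloorOneCIChartNotFull
import Summits.ResolutionOfSingularities.ResolutionOfSingularities.Theorems.FrobeniusLadderFInjectiveMacaulayficationTauFloorOneCIChartCM
import Summits.ResolutionOfSingularities.ResolutionOfSingularities.Theorems.FrobeniusLadderFInjectiveMacaulayficationE8Char5FiModel
import HarnessLib

/-!
# F4POS-1 (d-D1): the chart facts of floor 1 of the τ-tower, transported to the Rees chart ring `A₀[τ/ȳ]` (both models) at EVERY prime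
# (crux `FInjectiveMacaulayfication` stmt-ResolutionOfSingularities-15315, chain w45a; res-L1-w45a-plan-1 R18.17 (b)/R18.18 «F4POS-1 (d)»; seat res-L1-w45a-stub-1 g10)

[OURS · L1 W4.5a] Support file (`--supports stmt-ResolutionOfSingularities-15315 --as helper`); def-free, unconditional; replaces the role of NO printed item;
NOT a statement of the manuscript; AI-written (AI review is weaker than expert review).

`A₀ = k[X₀..X₄]/(f)` (P2d4C, char 2), `τ = (x̄², ȳ, ū, t̄, z̄)`, `ȳ = mk X₁`. Along `TauFloorOneCIChartIdent.exists_chartEquiv : C ≃+* blowupAlgebra τ ȳ` (p620521) and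
`reesChartEquiv ȳ : (A₀[τt])_{(ȳt)} ≃+* blowupAlgebra τ ȳ` (Literature), with `E8Char5FiModel.nonempty_ringEquiv_localization_comap` for the localisations:
* ★ `cmCl_localization_blowupAlgebra` — the CM clause at EVERY prime of the chart ring `A₀[τ/ȳ]` of `Bl_τ X` (from p617990);
* ★★ `not_fullCl_localization_blowupAlgebra` — `¬ FullCl 2` at EVERY prime containing `ȳ/1` (the exceptional divisor of the chart; in `C`, `ȳ ∈ 𝔮 ⇒ x̄, z̄′ ∈ 𝔮`
  since `x̄² = w̄ȳ`, `z̄′² ∈ (ȳ)`; from p617516).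
The further transport to the Proj chart ring `(A₀[τt])_{(ȳt)}` (`reesChartEquiv`; where `StalkChartIso.stub_stalkChartIso` lands) is left to the assembly file: the
naive `Localization.AtPrime (q.comap (reesChartEquiv ȳ).symm)` formulation does not elaborate within budget (whnf blow-up on the graded-algebra types); use
`Ideal.map (reesChartEquiv ȳ) q` + `IsLocalization.ringEquivOfRingEquiv` there. [folklore transport]
-/

-- single-problem summit: the doubled namespace component is forced
set_option linter.dupNamespace false

noncomputable section

namespace Summit.ResolutionOfSingularities.ResolutionOfSingularities.Theorems.FInjectiveMacaulayfication.TauFloorOneChartYTransport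

open MvPolynomial IsLocalRing Literature.AlgebraicGeometry.Resolution AlgebraicGeometry
open Summit.ResolutionOfSingularities.ResolutionOfSingularities.Theorems.FInjectiveMacaulayfication
open SliceableCentre TauFloorOneCIChartCore

variable (k : Type) [Field k] (f : MvPolynomial (Fin 5) k) (hf : f = X 4 ^ 2 + X 0 ^ 4 * X 4 + X 1 ^ 3 + X 2 ^ 3 + X 3 ^ 3)

/-! ## §1 In `C`: a prime containing `ȳ` contains `x̄` and `z̄′` -/

/-- In `C`: `ȳ ∈ 𝔮 ⇒ x̄ ∈ 𝔮 ∧ z̄′ ∈ 𝔮` for a prime `𝔮` (`x̄² = w̄ȳ`, `z̄′² = −ȳ(…)`). [plumbing] -/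
theorem mem_of_mem_y (g₁ g₂ : MvPolynomial (Fin 6) k) (hg₁ : g₁ = X 0 ^ 2 - X 2 * X 1)
    (hg₂ : g₂ = X 5 ^ 2 + X 1 * (1 + X 2 ^ 2 * X 5 + X 3 ^ 3 + X 4 ^ 3)) (Q : Ideal (MvPolynomial (Fin 6) k ⧸ Ideal.span {g₁, g₂}))
    [Q.IsPrime] (hy : Ideal.Quotient.mk (Ideal.span {g₁, g₂}) (X 1) ∈ Q) :
    Ideal.Quotient.mk (Ideal.span {g₁, g₂}) (X 0) ∈ Q ∧ Ideal.Quotient.mk (Ideal.span {g₁, g₂}) (X 5) ∈ Q := by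
  refine ⟨‹Q.IsPrime›.mem_of_pow_mem 2 ?_, ‹Q.IsPrime›.mem_of_pow_mem 2 ?_⟩
  · rw [← mk_X_two_mul_X_one k g₁ g₂ hg₁]; exact Q.mul_mem_left _ hy
  · rw [sq_z_eq k g₁ g₂ hg₂]; exact neg_mem (Q.mul_mem_right _ hy)

/-! ## §2 The affine blow-up algebra `blowupAlgebra τ ȳ` -/

include hf in
/-- ★ **CM at every prime of `A₀[τ/ȳ]`.** [folklore transport of p617990] -/
theorem cmCl_localization_blowupAlgebra
    (Q : Ideal (blowupAlgebra (Ideal.span {Ideal.Quotient.mk (Ideal.span {f}) (X 0) ^ 2, Ideal.Quotient.mk (Ideal.span {f}) (X 1),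
      Ideal.Quotient.mk (Ideal.span {f}) (X 2), Ideal.Quotient.mk (Ideal.span {f}) (X 3), Ideal.Quotient.mk (Ideal.span {f}) (X 4)} :
        Ideal (MvPolynomial (Fin 5) k ⧸ Ideal.span {f})) (Ideal.Quotient.mk (Ideal.span {f}) (X 1)))) [Q.IsPrime] :
    CMCl (Localization.AtPrime Q) := by
  obtain ⟨e, -⟩ := TauFloorOneCIChartIdent.exists_chartEquiv k f hf (X 0 ^ 2 - X 2 * X 1)
    (X 5 ^ 2 + X 1 * (1 + X 2 ^ 2 * X 5 + X 3 ^ 3 + X 4 ^ 3)) rfl rfl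
  obtain ⟨eQ⟩ := E8Char5FiModel.nonempty_ringEquiv_localization_comap e Q
  exact FiLocusOpenOfAffine.cmClause_of_ringEquiv eQ
    (TauFloorOneCIChartCM.cmCl_localization k _ _ rfl rfl (Q.comap e.toRingHom))

include hf in
/-- ★★ **`¬ FullCl 2` at every prime of `A₀[τ/ȳ]` containing `ȳ/1`** (the exceptional divisor of the chart `D(ȳ)`). [folklore transport of p617516] -/
theorem not_fullCl_localization_blowupAlgebra [CharP k 2]
    (Q : Ideal (blowupAlgebra (Ideal.span {Ideal.Quotient.mk (Ideal.span {f}) (X 0) ^ 2, Ideal.Quotient.mk (Ideal.span {f}) (X 1),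
      Ideal.Quotient.mk (Ideal.span {f}) (X 2), Ideal.Quotient.mk (Ideal.span {f}) (X 3), Ideal.Quotient.mk (Ideal.span {f}) (X 4)} :
        Ideal (MvPolynomial (Fin 5) k ⧸ Ideal.span {f})) (Ideal.Quotient.mk (Ideal.span {f}) (X 1)))) [Q.IsPrime]
    (hy : algebraMap (MvPolynomial (Fin 5) k ⧸ Ideal.span {f}) _ (Ideal.Quotient.mk (Ideal.span {f}) (X 1)) ∈ Q) :
    ¬ FullCl 2 (Localization.AtPrime Q) := by
  intro hfull
  obtain ⟨e, he⟩ := TauFloorOneCIChartIdent.exists_chartEquiv k f hf (X 0 ^ 2 - X 2 * X 1)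
    (X 5 ^ 2 + X 1 * (1 + X 2 ^ 2 * X 5 + X 3 ^ 3 + X 4 ^ 3)) rfl rfl
  obtain ⟨eQ⟩ := E8Char5FiModel.nonempty_ringEquiv_localization_comap e Q
  haveI : (Q.comap e.toRingHom).IsPrime := Ideal.IsPrime.comap _
  -- `ȳ ∈ e⁻¹Q` (since `e ȳ = ȳ/1`), hence `x̄, z̄′ ∈ e⁻¹Q`
  have hey : e (Ideal.Quotient.mk _ (X 1)) = algebraMap (MvPolynomial (Fin 5) k ⧸ Ideal.span {f}) _ (Ideal.Quotient.mk (Ideal.span {f}) (X 1)) :=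
    Subtype.ext (he 1)
  have hyC : Ideal.Quotient.mk (Ideal.span ({X 0 ^ 2 - X 2 * X 1, X 5 ^ 2 + X 1 * (1 + X 2 ^ 2 * X 5 + X 3 ^ 3 + X 4 ^ 3)} :
      Set (MvPolynomial (Fin 6) k))) (X 1) ∈ Q.comap e.toRingHom := by
    rw [Ideal.mem_comap, RingEquiv.toRingHom_eq_coe, RingEquiv.coe_toRingHom, hey]; exact hy
  obtain ⟨hxC, hzC⟩ := mem_of_mem_y k _ _ rfl rfl (Q.comap e.toRingHom) hyC
  -- the stalk of `Spec C` at `e⁻¹Q` is not FULL; transport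
  let w : Spec (.of (MvPolynomial (Fin 6) k ⧸ Ideal.span ({X 0 ^ 2 - X 2 * X 1, X 5 ^ 2 + X 1 * (1 + X 2 ^ 2 * X 5 + X 3 ^ 3 + X 4 ^ 3)} :
      Set (MvPolynomial (Fin 6) k)))) := ⟨Q.comap e.toRingHom, inferInstance⟩
  have hbad := TauFloorOneCIChartNotFull.not_fullCl_stalk_of_mem_VXYZ k _ _ rfl rfl w hxC hyC hzC
  exact hbad (WFixAtNonClosedDimTwo.fullCl_of_ringEquiv 2 (eQ.symm.trans (Spec.stalkIso (.of _) w).commRingCatIsoToRingEquiv.symm) hfull)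

end Summit.ResolutionOfSingularities.ResolutionOfSingularities.Theorems.FInjectiveMacaulayfication.TauFloorOneChartYTransport

end
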